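import Literature.AlgebraicGeometry.ModuliOfAbelianVarieties.SiegelModuliHilbertModularSurface
import Literature.AlgebraicGeometry.ModuliOfAbelianVarieties.SiegelFamilyHumbertModularGroupRunge
import HarnessLib

/-!
# The Hilbert modular surface is generically a double cover of the Humbert surface: `X = SL(O ⊕ O^∨)\ℍ² → H_Δ`
# factors through the symmetric Hilbert modular surface `(Γ ∪ Γσ)\ℍ²`, and the induced map is generically one to one
# (Elkies–Kumar 2014 §3–§4, after Hirzebruch–van der Geer; Runge 1999 §4 "the Humbert modular group `Γ(Δ_F)` is just
# the symmetric Hilbert modular group")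

Layer `Literature/AlgebraicGeometry/ModuliOfAbelianVarieties`, namespace
`Literature.AlgebraicGeometry.ModuliOfAbelianVarieties.SiegelModuli`; lane `lit-hodgefound` (Track 2 foundations
library, Layer A4), seat `lit-hodgefound-skel-4`, row **A4-71**, FILE 3 (definitions with bodies — the involution
`hilbertModularSurface.swap`, the symmetric Hilbert modular surface and its map to `𝒜₂` — theorems otherwise; NO named
fact, NO sorry, net debt 0). Joins row A4-70 F5 (`SiegelModuliHilbertModularSurface`: `hilbertModularSurface = SL(O ⊕ O^∨)\ℍ²`,
`hilbertToSiegel : X → 𝒜₂`, `range_hilbertToSiegel = humbertSurface Δ`) with FILE 2 of this row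
(`SiegelFamilyHumbertModularGroupRunge`: Runge's Lemma 4, `swap_mem_hilbertModularPairGroup`, `swapSp_mem_levelGD`,
`exists_mem_hilbertModularPairGroup_of_mk_modularEmbedding_eq`) and row A4-64 (`modularEmbedding_swap_eq_smul`), BY NAME.

## Source, verbatim

N. D. Elkies, A. Kumar, *K3 surfaces and equations for Hilbert modular surfaces*, Algebra & Number Theory 8 (2014), §4
(held `paper:arxiv-1209.3527` p0011 L91–L95): "the map `Γ\ℍ² → Sp₄(ℤ)\𝔖₂` (where `Γ = SL₂(O_D, O_D^*)`) factors
through the quotient `(Γ ∪ Γσ)\ℍ²`, where `σ` is the involution `(z₁, z₂) ↦ (z₂, z₁)` exchanging the two factors of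
`ℍ²`, and the induced map on this quotient is generically one to one [HvdG]."  §3 (p0009 L132–L140): "Its image … is
the Humbert surface `𝓗_D` … the map from the Hilbert modular surface … to the Humbert surface is generically `2` to
`1`. … Generically, there are exactly two ways to extend the obvious map `ℤ → End(A) ≅ O_D` to `O_D`, corresponding to
the choice of image of `(D + √D)/2`."  B. Runge, Tohoku Math. J. 51 (1999), §4 p. 291 (after Lemma 4): "We remark
that the Humbert modular group `Γ(Δ_F)` is just the symmetric Hubert modular group if `O` is the full ring of
integers `O_F` in a real quadratic number field."  ([HvdG] = F. Hirzebruch, G. van der Geer, *Lectures on Hilbert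
modular surfaces* (1981), cited through Elkies–Kumar.)

"Generically" is rendered as in rows A4-65 F4 / A4-71 F1: at the `τ ∈ ℍ × ℍ` whose surface `X_{π[R](τ)}` has relation
lattice exactly `ℤ · (k, l, −1, 0, 0)` (a residual, dense set, `dense_setOf_forall_singularRelation_modularEmbedding`),
and, for "`2` to `1`", moreover `σ[τ] ≠ [τ]` (again residual and dense, §4: Baire on `ℍ × ℍ`).

## Contents (proved; no named fact)

* §1 **`hilbertModularSurface.swap`** (the involution `σ` of `X = SL(O ⊕ O^∨)\ℍ²` induced by `(τ₁, τ₂) ↦ (τ₂, τ₁)`,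
  well defined because `SL(O ⊕ O^∨)` is Galois-stable, FILE 2), `swap_mk`, `swap_swap`, `continuous_swap`,
  **`hilbertToSiegel_swap`** (E–K: `X → 𝒜₂` FACTORS THROUGH `σ`: `π[R](τ^σ) = σ_Gal · π[R](τ)` with `σ_Gal ∈ Sp₄(ℤ)`).
* §2 **`symmHilbertModularSurface = (Γ ∪ Γσ)\ℍ²`** (as `X/σ`), `symmHilbertModularSurface.mk`, **`symmHilbertToSiegel`**
  (the induced map), `symmHilbertToSiegel_mk`, `continuous_symmHilbertToSiegel`, **`range_symmHilbertToSiegel`**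
  (`= humbertSurface Δ`).
* §3 GENERICALLY ONE TO ONE / TWO TO ONE: **`hilbertToSiegel_eq_iff_of_forall`** (for `τ` with relation lattice
  `ℤq₀`: `hilbertToSiegel y = hilbertToSiegel [τ] ⟺ y = [τ] ∨ y = σ[τ]` — the fibre of `X → H_Δ` through a general point
  is `{[τ], σ[τ]}`), **`symmHilbertToSiegel_eq_iff_of_forall`** / **`injOn_symmHilbertToSiegel`** (the induced map is
  injective at the general points) and **`dense_image_mk_setOf_forall`** (those points are dense in `(Γ ∪ Γσ)\ℍ²`).

* §4 GENERICALLY TWO TO ONE: `slPairSp_injective`, `modularEmbeddingLift_injective`,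
  **`countable_hilbertModularPairGroup`** (`SL(O ⊕ O^∨)` embeds in `Sp₄(ℤ)`), `hilbertModularSurface.mk_eq_mk_iff`,
  **`hilbertModularSurface.swap_mk_eq_mk_iff`** (`σ[τ] = [τ] ⟺ γ · τ = τ^σ` for some `γ ∈ Γ`),
  private `isClosed_setOf_smul_apply_eq` / `interior_setOf_smul_apply_eq_eq_empty` (the "graphs" `{τ₂ = h · τ₁}` are
  closed and nowhere dense in `ℍ²` — elementary, hence private), **`setOf_swap_mk_ne_mk_mem_residual`** / `dense_setOf_swap_mk_ne_mk` (the `τ` with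
  `σ[τ] ≠ [τ]` are residual, hence dense — Baire on `ℍ²`), `setOf_forall_and_swap_mk_ne_mk_mem_residual` /
  `dense_setOf_forall_and_swap_mk_ne_mk`, **`preimage_hilbertToSiegel_singleton_eq_of_forall`** (the fibre over the
  image of a general `[τ]` is `{[τ], σ[τ]}`), **`ncard_preimage_hilbertToSiegel_singleton_eq_two`** and
  **`exists_dense_forall_ncard_preimage_hilbertToSiegel_eq_two`** ("generically `2` to `1`": exactly two points over a
  dense set of `X`), `preimage_symmHilbertModularSurface_mk_singleton_eq`.

## Scope

Not formalised: Hausmann's explicit description of the fixed curves `F_w` of `σ` (only: the `τ` with `σ[τ] = [τ]` lie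
in a countable union of closed nowhere dense graphs), the branch locus, degrees / analytic structure; `O` need not be
maximal here (Runge's remark is quoted for `O = O_F` only as the name "symmetric Hilbert modular group").

## References

* [ElkiesKumar2014HilbertModularSurfaces] N. D. Elkies, A. Kumar, Algebra & Number Theory 8 (2014), §3, §4.
* [Runge1999EndomorphismRingsAbelianSurfaces] B. Runge, Tohoku Math. J. 51 (1999) 283–303, §4 p. 291 (Lemma 4 and the
  remark after it).
* [HashimotoMurabayashi1995] K. Hashimoto, N. Murabayashi, Tohoku Math. J. 47 (1995), Def. 3.6, Prop. 3.7.
-/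

noncomputable section

open Matrix Complex Module Function Topology
open scoped UpperHalfPlane

namespace Literature.AlgebraicGeometry.ModuliOfAbelianVarieties

namespace SiegelModuli

open Literature.NumberTheory.Automorphic (siegelUpperHalfSpace)
open Literature.NumberTheory.ModularForms.SiegelUpperHalfSpace

variable {k l : ℤ}

/-! ## §1 The involution `σ` of `X = SL(O ⊕ O^∨)\ℍ²` and the factorisation of `X → 𝒜₂` through it -/

section Swap

/-- `(τ^σ)^σ = τ`. [cite: ElkiesKumar2014HilbertModularSurfaces, §4] -/
theorem comp_swap_comp_swap (τ : Fin 2 → ℍ) :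
    (τ ∘ ⇑(Equiv.swap (0 : Fin 2) 1)) ∘ ⇑(Equiv.swap (0 : Fin 2) 1) = τ := by
  funext s; simp [Equiv.swap_apply_self]

/-- **`[π[R](τ^σ)] = [π[R](τ)]` in `𝒜₂`**: the Galois involution is induced by `σ_Gal ∈ Sp₄(ℤ)` (row A4-64
`modularEmbedding_swap_eq_smul`, FILE 2 `swapSp_mem_levelGD`). [cite: ElkiesKumar2014HilbertModularSurfaces, §3 ("generically `2` to `1`") and §4] -/
theorem siegelThreefold.mk_modularEmbedding_comp_swap (hΔ : 0 < quadDisc k l) (τ : Fin 2 → ℍ) :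
    siegelThreefold.mk (modularEmbedding k l hΔ (τ ∘ ⇑(Equiv.swap (0 : Fin 2) 1))) =
      siegelThreefold.mk (modularEmbedding k l hΔ τ) := by
  obtain ⟨M, hM⟩ := (siegelThreefold.mem_levelGD_one_iff principalType_pos).1 (swapSp_mem_levelGD l)
  rw [modularEmbedding_swap_eq_smul, ← hM, siegelThreefold.mk_smul]

/-- **The involution `σ : X → X`, `[τ] ↦ [τ^σ]`, of the Hilbert modular surface `X = SL(O ⊕ O^∨)\ℍ²`** (well defined:
`SL(O ⊕ O^∨)` is stable under Galois conjugation, FILE 2 `swap_mem_hilbertModularPairGroup`).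
[cite: ElkiesKumar2014HilbertModularSurfaces, §4 ("`σ` is the involution `(z₁, z₂) ↦ (z₂, z₁)`")] -/
def hilbertModularSurface.swap (hΔ : 0 < quadDisc k l) : hilbertModularSurface k l hΔ → hilbertModularSurface k l hΔ :=
  Quotient.lift (fun τ ↦ hilbertModularSurface.mk k l hΔ (τ ∘ ⇑(Equiv.swap (0 : Fin 2) 1))) (by
    rintro τ τ' ⟨γ, rfl⟩
    exact hilbertModularSurface.mk_smul hΔ ⟨_, swap_mem_hilbertModularPairGroup hΔ γ.2⟩
      (τ' ∘ ⇑(Equiv.swap (0 : Fin 2) 1)))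

/-- `σ[τ] = [τ^σ]`. [cite: ElkiesKumar2014HilbertModularSurfaces, §4] -/
@[simp] theorem hilbertModularSurface.swap_mk (hΔ : 0 < quadDisc k l) (τ : Fin 2 → ℍ) :
    hilbertModularSurface.swap hΔ (hilbertModularSurface.mk k l hΔ τ) =
      hilbertModularSurface.mk k l hΔ (τ ∘ ⇑(Equiv.swap (0 : Fin 2) 1)) := rfl

/-- `σ² = 1` on `X`. [cite: ElkiesKumar2014HilbertModularSurfaces, §4] -/
theorem hilbertModularSurface.swap_swap (hΔ : 0 < quadDisc k l) (x : hilbertModularSurface k l hΔ) :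
    hilbertModularSurface.swap hΔ (hilbertModularSurface.swap hΔ x) = x := by
  induction x using Quotient.inductionOn with
  | h τ =>
    show hilbertModularSurface.mk k l hΔ ((τ ∘ ⇑(Equiv.swap (0 : Fin 2) 1)) ∘ ⇑(Equiv.swap (0 : Fin 2) 1)) =
      hilbertModularSurface.mk k l hΔ τ
    rw [comp_swap_comp_swap]

/-- `σ` is an involution of `X`. [cite: ElkiesKumar2014HilbertModularSurfaces, §4] -/
theorem hilbertModularSurface.involutive_swap (hΔ : 0 < quadDisc k l) : Involutive (hilbertModularSurface.swap hΔ) :=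
  hilbertModularSurface.swap_swap hΔ

/-- `σ : X → X` is continuous. [cite: ElkiesKumar2014HilbertModularSurfaces, §4] -/
theorem hilbertModularSurface.continuous_swap (hΔ : 0 < quadDisc k l) : Continuous (hilbertModularSurface.swap hΔ) :=
  Continuous.quotient_lift ((hilbertModularSurface.continuous_mk hΔ).comp
    (continuous_pi fun s ↦ continuous_apply (Equiv.swap (0 : Fin 2) 1 s))) _

/-- **ELKIES–KUMAR: `X → 𝒜₂` FACTORS THROUGH `σ` — `hilbertToSiegel (σ x) = hilbertToSiegel x`** (forgetting the real
multiplication identifies `(A, ι)` with `(A, ι ∘ Gal)`). [cite: ElkiesKumar2014HilbertModularSurfaces, §3 and §4] -/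
theorem hilbertToSiegel_swap (hΔ : 0 < quadDisc k l) (x : hilbertModularSurface k l hΔ) :
    hilbertToSiegel k l hΔ (hilbertModularSurface.swap hΔ x) = hilbertToSiegel k l hΔ x := by
  induction x using Quotient.inductionOn with
  | h τ => exact siegelThreefold.mk_modularEmbedding_comp_swap hΔ τ

end Swap

/-! ## §2 The symmetric Hilbert modular surface `(Γ ∪ Γσ)\ℍ² = X/σ` and the induced map to `𝒜₂` -/

section Symmetric

/-- The relation `y = x ∨ y = σ x` on `X` (an equivalence relation since `σ² = 1`).
[cite: ElkiesKumar2014HilbertModularSurfaces, §4 ("the quotient `(Γ ∪ Γσ)\ℍ²`")] -/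
def symmHilbertModularSurface.setoid (k l : ℤ) (hΔ : 0 < quadDisc k l) : Setoid (hilbertModularSurface k l hΔ) where
  r x y := y = x ∨ y = hilbertModularSurface.swap hΔ x
  iseqv :=
    { refl := fun x ↦ Or.inl rfl
      symm := by
        rintro x y (rfl | rfl)
        · exact Or.inl rfl
        · exact Or.inr (hilbertModularSurface.swap_swap hΔ x).symm
      trans := by
        rintro x y z (rfl | rfl) (rfl | rfl)
        · exact Or.inl rfl
        · exact Or.inr rfl
        · exact Or.inr rfl
        · exact Or.inl (hilbertModularSurface.swap_swap hΔ x) }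

/-- **The symmetric Hilbert modular surface `(Γ ∪ Γσ)\ℍ²`, `Γ = SL(O ⊕ O^∨)`**, realised as `X/σ` with the quotient
topology ("the Humbert modular group `Γ(Δ_F)` is just the symmetric Hilbert modular group", Runge).
[cite: ElkiesKumar2014HilbertModularSurfaces, §4] [cite: Runge1999EndomorphismRingsAbelianSurfaces, §4 p. 291] -/
abbrev symmHilbertModularSurface (k l : ℤ) (hΔ : 0 < quadDisc k l) : Type :=
  Quotient (symmHilbertModularSurface.setoid k l hΔ)

/-- The canonical map `ℍ × ℍ → (Γ ∪ Γσ)\ℍ²`. [cite: ElkiesKumar2014HilbertModularSurfaces, §4] -/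
def symmHilbertModularSurface.mk (k l : ℤ) (hΔ : 0 < quadDisc k l) (τ : Fin 2 → ℍ) : symmHilbertModularSurface k l hΔ :=
  Quotient.mk (symmHilbertModularSurface.setoid k l hΔ) (hilbertModularSurface.mk k l hΔ τ)

/-- `ℍ × ℍ → (Γ ∪ Γσ)\ℍ²` is continuous. [cite: ElkiesKumar2014HilbertModularSurfaces, §4] -/
theorem symmHilbertModularSurface.continuous_mk (hΔ : 0 < quadDisc k l) : Continuous (symmHilbertModularSurface.mk k l hΔ) :=
  continuous_quotient_mk'.comp (hilbertModularSurface.continuous_mk hΔ)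

/-- `ℍ × ℍ → (Γ ∪ Γσ)\ℍ²` is onto. [cite: ElkiesKumar2014HilbertModularSurfaces, §4] -/
theorem symmHilbertModularSurface.mk_surjective (hΔ : 0 < quadDisc k l) : Surjective (symmHilbertModularSurface.mk k l hΔ) :=
  Quotient.mk_surjective.comp (hilbertModularSurface.mk_surjective hΔ)

/-- `[γ · τ] = [τ]` in `(Γ ∪ Γσ)\ℍ²` for `γ ∈ SL(O ⊕ O^∨)`. [cite: ElkiesKumar2014HilbertModularSurfaces, §4] -/
theorem symmHilbertModularSurface.mk_smul (hΔ : 0 < quadDisc k l) (γ : hilbertModularPairGroup k l hΔ) (τ : Fin 2 → ℍ) :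
    symmHilbertModularSurface.mk k l hΔ (γ • τ) = symmHilbertModularSurface.mk k l hΔ τ := by
  rw [symmHilbertModularSurface.mk, hilbertModularSurface.mk_smul]
  rfl

/-- `[τ^σ] = [τ]` in `(Γ ∪ Γσ)\ℍ²`. [cite: ElkiesKumar2014HilbertModularSurfaces, §4] -/
theorem symmHilbertModularSurface.mk_comp_swap (hΔ : 0 < quadDisc k l) (τ : Fin 2 → ℍ) :
    symmHilbertModularSurface.mk k l hΔ (τ ∘ ⇑(Equiv.swap (0 : Fin 2) 1)) = symmHilbertModularSurface.mk k l hΔ τ := by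
  apply Eq.symm
  apply Quotient.sound
  show _ = _ ∨ _ = hilbertModularSurface.swap hΔ (hilbertModularSurface.mk k l hΔ τ)
  exact Or.inr rfl

/-- **The induced map `(Γ ∪ Γσ)\ℍ² → 𝒜₂`** ("the map `Γ\ℍ² → Sp₄(ℤ)\𝔖₂` … factors through the quotient `(Γ ∪ Γσ)\ℍ²`").
[cite: ElkiesKumar2014HilbertModularSurfaces, §4] -/
def symmHilbertToSiegel (k l : ℤ) (hΔ : 0 < quadDisc k l) : symmHilbertModularSurface k l hΔ → siegelThreefold :=
  Quotient.lift (hilbertToSiegel k l hΔ) (by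
    rintro x y (rfl | rfl)
    · rfl
    · exact (hilbertToSiegel_swap hΔ x).symm)

/-- `symmHilbertToSiegel [τ] = [π[R](τ)]`. [cite: ElkiesKumar2014HilbertModularSurfaces, §4] -/
@[simp] theorem symmHilbertToSiegel_mk (hΔ : 0 < quadDisc k l) (τ : Fin 2 → ℍ) :
    symmHilbertToSiegel k l hΔ (symmHilbertModularSurface.mk k l hΔ τ) = siegelThreefold.mk (modularEmbedding k l hΔ τ) :=
  rfl

/-- THE FACTORISATION: `hilbertToSiegel = symmHilbertToSiegel ∘ (X → X/σ)`. [cite: ElkiesKumar2014HilbertModularSurfaces, §4] -/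
theorem symmHilbertToSiegel_comp_mk (hΔ : 0 < quadDisc k l) :
    symmHilbertToSiegel k l hΔ ∘ Quotient.mk (symmHilbertModularSurface.setoid k l hΔ) = hilbertToSiegel k l hΔ :=
  rfl

/-- `(Γ ∪ Γσ)\ℍ² → 𝒜₂` is continuous. [cite: ElkiesKumar2014HilbertModularSurfaces, §4] -/
theorem continuous_symmHilbertToSiegel (hΔ : 0 < quadDisc k l) : Continuous (symmHilbertToSiegel k l hΔ) :=
  Continuous.quotient_lift (continuous_hilbertToSiegel hΔ) _

/-- **The image of `(Γ ∪ Γσ)\ℍ² → 𝒜₂` is the Humbert surface `H_Δ`, `Δ = l² + 4k`.** [cite: ElkiesKumar2014HilbertModularSurfaces, §3 ("Its image … is the Humbert surface")] [cite: HashimotoMurabayashi1995, Prop. 3.7] -/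
theorem range_symmHilbertToSiegel (hΔ : 0 < quadDisc k l) :
    Set.range (symmHilbertToSiegel k l hΔ) = humbertSurface (quadDisc k l) := by
  rw [← range_hilbertToSiegel hΔ]
  ext x
  constructor
  · rintro ⟨t, rfl⟩
    induction t using Quotient.inductionOn with
    | h y => exact ⟨y, rfl⟩
  · rintro ⟨y, rfl⟩
    exact ⟨Quotient.mk _ y, rfl⟩

end Symmetric

/-! ## §3 "Generically one to one": the fibres through the general points -/

section Generic

/-- **THE FIBRE OF `X → H_Δ` THROUGH A GENERAL POINT IS `{[τ], σ[τ]}`** ("the map from the Hilbert modular surface … to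
the Humbert surface is generically `2` to `1`"): if `X_{π[R](τ)}` has relation lattice `ℤ · (k, l, −1, 0, 0)`, then
`hilbertToSiegel y = hilbertToSiegel [τ] ⟺ y = [τ] ∨ y = σ[τ]` (Runge's Lemma 4, FILE 2).
[cite: ElkiesKumar2014HilbertModularSurfaces, §3 and §4] [cite: Runge1999EndomorphismRingsAbelianSurfaces, §3 p. 287 and §4 p. 291] -/
theorem hilbertToSiegel_eq_iff_of_forall (hΔ : 0 < quadDisc k l) {τ : Fin 2 → ℍ}
    (hgen : ∀ q' : Fin 5 → ℤ, singularRelation (fun i ↦ (q' i : ℂ))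
      (modularEmbedding k l hΔ τ : Matrix (Fin 2) (Fin 2) ℂ) = 0 → ∃ m : ℤ, q' = m • humbertNormalForm k l)
    (y : hilbertModularSurface k l hΔ) :
    hilbertToSiegel k l hΔ y = hilbertToSiegel k l hΔ (hilbertModularSurface.mk k l hΔ τ) ↔
      y = hilbertModularSurface.mk k l hΔ τ ∨
        y = hilbertModularSurface.swap hΔ (hilbertModularSurface.mk k l hΔ τ) := by
  constructor
  · intro h
    induction y using Quotient.inductionOn with
    | h τ' =>
      have h' : siegelThreefold.mk (modularEmbedding k l hΔ τ) = siegelThreefold.mk (modularEmbedding k l hΔ τ') := by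
        rw [← hilbertToSiegel_mk hΔ τ, ← hilbertToSiegel_mk hΔ τ']
        exact h.symm
      obtain ⟨g, hg, rfl | rfl⟩ := exists_mem_hilbertModularPairGroup_of_mk_modularEmbedding_eq hΔ hgen h'
      · exact Or.inl (hilbertModularSurface.mk_smul hΔ ⟨g, hg⟩ τ)
      · right
        rw [hilbertModularSurface.swap_mk]
        exact hilbertModularSurface.mk_smul hΔ ⟨g, hg⟩ (τ ∘ ⇑(Equiv.swap (0 : Fin 2) 1))
  · rintro (rfl | rfl)
    · rfl
    · exact hilbertToSiegel_swap hΔ _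

/-- **"The induced map on this quotient is generically one to one": at a general `τ`, `symmHilbertToSiegel y =
symmHilbertToSiegel [τ]` forces `y = [τ]` in `(Γ ∪ Γσ)\ℍ²`.** [cite: ElkiesKumar2014HilbertModularSurfaces, §4] -/
theorem symmHilbertToSiegel_eq_iff_of_forall (hΔ : 0 < quadDisc k l) {τ : Fin 2 → ℍ}
    (hgen : ∀ q' : Fin 5 → ℤ, singularRelation (fun i ↦ (q' i : ℂ))
      (modularEmbedding k l hΔ τ : Matrix (Fin 2) (Fin 2) ℂ) = 0 → ∃ m : ℤ, q' = m • humbertNormalForm k l)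
    (y : symmHilbertModularSurface k l hΔ) :
    symmHilbertToSiegel k l hΔ y = symmHilbertToSiegel k l hΔ (symmHilbertModularSurface.mk k l hΔ τ) ↔
      y = symmHilbertModularSurface.mk k l hΔ τ := by
  refine ⟨fun h ↦ ?_, fun h ↦ by rw [h]⟩
  induction y using Quotient.inductionOn with
  | h x =>
    rcases (hilbertToSiegel_eq_iff_of_forall hΔ hgen x).1 h with rfl | rfl
    · rfl
    · apply Eq.symm
      apply Quotient.sound
      show _ = _ ∨ _ = hilbertModularSurface.swap hΔ (hilbertModularSurface.mk k l hΔ τ)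
      exact Or.inr rfl

/-- **`(Γ ∪ Γσ)\ℍ² → 𝒜₂` is injective on the images of the general `τ`.** [cite: ElkiesKumar2014HilbertModularSurfaces, §4] -/
theorem injOn_symmHilbertToSiegel (hΔ : 0 < quadDisc k l) :
    Set.InjOn (symmHilbertToSiegel k l hΔ) (symmHilbertModularSurface.mk k l hΔ ''
      {τ | ∀ q' : Fin 5 → ℤ, singularRelation (fun i ↦ (q' i : ℂ))
        (modularEmbedding k l hΔ τ : Matrix (Fin 2) (Fin 2) ℂ) = 0 → ∃ m : ℤ, q' = m • humbertNormalForm k l}) := by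
  rintro _ ⟨τ, hτ, rfl⟩ y - h
  exact ((symmHilbertToSiegel_eq_iff_of_forall hΔ hτ y).1 h.symm).symm

/-- **… and those images are DENSE in `(Γ ∪ Γσ)\ℍ²`** (the general `τ` are dense in `ℍ × ℍ`, row A4-65 F4).
[cite: ElkiesKumar2014HilbertModularSurfaces, §4 ("generically")] [cite: BirkenhakeWilhelm2003, §4 Prop. 4.9 (p. 1831)] -/
theorem dense_image_symmHilbertModularSurface_mk_setOf_forall (hΔ : 0 < quadDisc k l) :
    Dense (symmHilbertModularSurface.mk k l hΔ ''
      {τ | ∀ q' : Fin 5 → ℤ, singularRelation (fun i ↦ (q' i : ℂ))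
        (modularEmbedding k l hΔ τ : Matrix (Fin 2) (Fin 2) ℂ) = 0 → ∃ m : ℤ, q' = m • humbertNormalForm k l}) :=
  (symmHilbertModularSurface.mk_surjective hΔ).denseRange.dense_image (symmHilbertModularSurface.continuous_mk hΔ)
    (dense_setOf_forall_singularRelation_modularEmbedding k l hΔ)

/-- The same one level up: the general `[τ]` are dense in `X` and `X → 𝒜₂` is two to one there in the sense of
`hilbertToSiegel_eq_iff_of_forall`. [cite: ElkiesKumar2014HilbertModularSurfaces, §3 ("generically `2` to `1`")] -/
theorem dense_image_hilbertModularSurface_mk_setOf_forall (hΔ : 0 < quadDisc k l) :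
    Dense (hilbertModularSurface.mk k l hΔ ''
      {τ | ∀ q' : Fin 5 → ℤ, singularRelation (fun i ↦ (q' i : ℂ))
        (modularEmbedding k l hΔ τ : Matrix (Fin 2) (Fin 2) ℂ) = 0 → ∃ m : ℤ, q' = m • humbertNormalForm k l}) :=
  (hilbertModularSurface.mk_surjective hΔ).denseRange.dense_image (hilbertModularSurface.continuous_mk hΔ)
    (dense_setOf_forall_singularRelation_modularEmbedding k l hΔ)

end Generic

/-! ## §4 "Generically `2` to `1`": `σ[τ] ≠ [τ]` off a meagre set, so the general fibre has exactly two points -/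

section TwoToOne

/-- `σ : SL₂(ℝ)² → Sp₄(ℝ)` is injective (the blocks of `σ(g)` are the diagonal matrices of the entries of `g`).
[cite: Runge1999EndomorphismRingsAbelianSurfaces, §4 p. 290] -/
theorem slPairSp_injective : Injective slPairSp := by
  intro g h e
  have e' := congrArg (fun A : Matrix.symplecticGroup (Fin 2) ℝ ↦ (A : Matrix (Fin 2 ⊕ Fin 2) (Fin 2 ⊕ Fin 2) ℝ)) e
  simp only [coe_slPairSp, slPairMatrix, Matrix.fromBlocks_inj, diagonal_eq_diagonal_iff] at e'
  obtain ⟨h00, h01, h10, h11⟩ := e'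
  funext s
  ext i j
  fin_cases i <;> fin_cases j <;>
    first | exact h00 s | exact h01 s | exact h10 s | exact h11 s

/-- Runge's lift `g ↦ (ᵗR 0; 0 R⁻¹) σ(g) (ᵗR 0; 0 R⁻¹)⁻¹` is injective. [cite: Runge1999EndomorphismRingsAbelianSurfaces, §4 p. 291] -/
theorem modularEmbeddingLift_injective (hΔ : 0 < quadDisc k l) : Injective (modularEmbeddingLift k l hΔ) := by
  intro g h e
  unfold modularEmbeddingLift at e
  exact slPairSp_injective (mul_left_cancel (mul_right_cancel e))

/-- **`SL(O ⊕ O^∨)` is countable** (it embeds into `Sp₄(ℤ)` by the lift). [cite: Runge1999EndomorphismRingsAbelianSurfaces, §4 p. 291] [cite: ElkiesKumar2014HilbertModularSurfaces, §3] -/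
theorem countable_hilbertModularPairGroup (hΔ : 0 < quadDisc k l) : Countable (hilbertModularPairGroup k l hΔ) := by
  haveI : Countable (Matrix (Fin 2 ⊕ Fin 2) (Fin 2 ⊕ Fin 2) ℤ) :=
    inferInstanceAs (Countable ((Fin 2 ⊕ Fin 2) → (Fin 2 ⊕ Fin 2) → ℤ))
  have h : ∀ γ : hilbertModularPairGroup k l hΔ, ∃ M : Matrix (Fin 2 ⊕ Fin 2) (Fin 2 ⊕ Fin 2) ℤ,
      toGD (fun _ : Fin 2 ↦ 1) M =
        ((modularEmbeddingLift k l hΔ γ : Matrix.symplecticGroup (Fin 2) ℝ) :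
          Matrix (Fin 2 ⊕ Fin 2) (Fin 2 ⊕ Fin 2) ℝ) := by
    intro γ
    obtain ⟨M, -, hM⟩ := (mem_range_gDHom_one_iff _).1 ((mem_hilbertModularPairGroup_iff_mem_range hΔ _).1 γ.2)
    exact ⟨M, hM⟩
  choose f hf using h
  refine Function.Injective.countable (f := f) fun γ γ' e ↦ ?_
  have e' : modularEmbeddingLift k l hΔ γ = modularEmbeddingLift k l hΔ γ' :=
    Subtype.ext (by rw [← hf γ, ← hf γ', e])
  exact Subtype.ext (modularEmbeddingLift_injective hΔ e')

/-- `[τ] = [τ′]` in `X = SL(O ⊕ O^∨)\ℍ²` iff `τ = γ · τ′` for some `γ ∈ SL(O ⊕ O^∨)`. [cite: ElkiesKumar2014HilbertModularSurfaces, §3] -/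
theorem hilbertModularSurface.mk_eq_mk_iff (hΔ : 0 < quadDisc k l) (τ τ' : Fin 2 → ℍ) :
    hilbertModularSurface.mk k l hΔ τ = hilbertModularSurface.mk k l hΔ τ' ↔
      ∃ γ ∈ hilbertModularPairGroup k l hΔ, (fun s ↦ γ s • τ' s) = τ := by
  refine Quotient.eq.trans (MulAction.orbitRel_apply.trans (MulAction.mem_orbit_iff.trans ?_))
  exact ⟨fun ⟨γ, h⟩ ↦ ⟨γ, γ.2, h⟩, fun ⟨γ, hγ, h⟩ ↦ ⟨⟨γ, hγ⟩, h⟩⟩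

/-- **The fixed points of `σ` on `X` come from the `τ` with a `γσ`-symmetry: `σ[τ] = [τ] ⟺ γ · τ = τ^σ` for some
`γ ∈ SL(O ⊕ O^∨)`** ("the fixed point set of `σ` on `Γ\ℍ²` … was done by Hausmann"). [cite: ElkiesKumar2014HilbertModularSurfaces, §4] -/
theorem hilbertModularSurface.swap_mk_eq_mk_iff (hΔ : 0 < quadDisc k l) (τ : Fin 2 → ℍ) :
    hilbertModularSurface.swap hΔ (hilbertModularSurface.mk k l hΔ τ) = hilbertModularSurface.mk k l hΔ τ ↔
      ∃ γ ∈ hilbertModularPairGroup k l hΔ, (fun s ↦ γ s • τ s) = τ ∘ ⇑(Equiv.swap (0 : Fin 2) 1) := by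
  rw [hilbertModularSurface.swap_mk, hilbertModularSurface.mk_eq_mk_iff]

/-- `ℍ` has no isolated points. [folklore] -/
private theorem not_isOpen_singleton_upperHalfPlane (z : ℍ) : ¬ IsOpen ({z} : Set ℍ) := by
  intro h
  have h' : IsOpen ({(z : ℂ)} : Set ℂ) := by
    rw [← Set.image_singleton]; exact UpperHalfPlane.isOpenEmbedding_coe.isOpenMap _ h
  exact (inferInstance : (𝓝[≠] (z : ℂ)).NeBot).ne ((isOpen_singleton_iff_punctured_nhds _).1 h')

/-- Each `h ∈ SL₂(ℝ)` acts continuously on `ℍ`. [folklore] -/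
private theorem continuous_specialLinearGroup_smul (h : Matrix.SpecialLinearGroup (Fin 2) ℝ) :
    Continuous fun z : ℍ ↦ h • z :=
  continuous_const_smul (Matrix.SpecialLinearGroup.mapGL ℝ h : GL (Fin 2) ℝ)

/-- The "graph" `{τ ∈ ℍ² | h · τ₁ = τ₂}` of `h ∈ SL₂(ℝ)` is closed … [folklore] -/
private theorem isClosed_setOf_smul_apply_eq (h : Matrix.SpecialLinearGroup (Fin 2) ℝ) :
    IsClosed {τ : Fin 2 → ℍ | h • τ 0 = τ 1} :=
  isClosed_eq ((continuous_specialLinearGroup_smul h).comp (continuous_apply 0)) (continuous_apply 1)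

/-- … and nowhere dense (move `τ₂` off `h · τ₁`; `ℍ` has no isolated points). [folklore] -/
private theorem interior_setOf_smul_apply_eq_eq_empty (h : Matrix.SpecialLinearGroup (Fin 2) ℝ) :
    interior {τ : Fin 2 → ℍ | h • τ 0 = τ 1} = ∅ := by
  rw [Set.eq_empty_iff_forall_notMem]
  intro τ hτ
  have hτ' : τ ∈ {τ : Fin 2 → ℍ | h • τ 0 = τ 1} := interior_subset hτ
  rw [Set.mem_setOf_eq] at hτ'
  set v : ℍ → (Fin 2 → ℍ) := fun z ↦ update τ 1 z with hv
  have hvc : Continuous v := continuous_const.update 1 continuous_id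
  have hpre : IsOpen (v ⁻¹' interior {τ : Fin 2 → ℍ | h • τ 0 = τ 1}) := isOpen_interior.preimage hvc
  have heq : v ⁻¹' interior {τ : Fin 2 → ℍ | h • τ 0 = τ 1} = {τ 1} := by
    refine Set.Subset.antisymm (fun z hz ↦ ?_) ?_
    · have hz' : v z ∈ {τ : Fin 2 → ℍ | h • τ 0 = τ 1} := interior_subset hz
      rw [Set.mem_setOf_eq] at hz'
      simp only [hv, update_self, update_of_ne (show (0 : Fin 2) ≠ 1 by decide)] at hz'
      rw [Set.mem_singleton_iff, ← hz', hτ']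
    · rintro z rfl
      rw [Set.mem_preimage, show v (τ 1) = τ from update_eq_self 1 τ]
      exact hτ
  exact not_isOpen_singleton_upperHalfPlane (τ 1) (heq ▸ hpre)

/-- **THE `τ` WITH `σ[τ] ≠ [τ]` FORM A RESIDUAL SUBSET OF `ℍ × ℍ`**: its complement lies in the countable union, over
`γ ∈ SL(O ⊕ O^∨)`, of the closed nowhere dense "graphs" `{τ₂ = γ₁ · τ₁}` (the lane's rendering of "the fixed point
set of `σ` on `Γ\ℍ²` consists of … curves `F_w`" — Hausmann's explicit description is NOT formalised).
[cite: ElkiesKumar2014HilbertModularSurfaces, §3 ("generically `2` to `1`") and §4 ("the fixed point set of `σ`", [Ha])] -/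
theorem setOf_swap_mk_ne_mk_mem_residual (hΔ : 0 < quadDisc k l) :
    {τ : Fin 2 → ℍ | hilbertModularSurface.swap hΔ (hilbertModularSurface.mk k l hΔ τ) ≠
      hilbertModularSurface.mk k l hΔ τ} ∈ residual (Fin 2 → ℍ) := by
  haveI := countable_hilbertModularPairGroup hΔ
  have hsub : (⋂ γ : hilbertModularPairGroup k l hΔ,
      {τ : Fin 2 → ℍ | (γ : Fin 2 → Matrix.SpecialLinearGroup (Fin 2) ℝ) 0 • τ 0 = τ 1}ᶜ) ⊆
      {τ : Fin 2 → ℍ | hilbertModularSurface.swap hΔ (hilbertModularSurface.mk k l hΔ τ) ≠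
        hilbertModularSurface.mk k l hΔ τ} := by
    intro τ hτ heq
    obtain ⟨γ, hγ, h⟩ := (hilbertModularSurface.swap_mk_eq_mk_iff hΔ τ).1 heq
    have h0 := congrFun h 0
    simp only [Function.comp_apply, Equiv.swap_apply_left] at h0
    exact Set.mem_iInter.1 hτ ⟨γ, hγ⟩ h0
  refine Filter.mem_of_superset ?_ hsub
  rw [countable_iInter_mem]
  intro γ
  refine residual_of_dense_open (isClosed_setOf_smul_apply_eq _).isOpen_compl ?_
  rw [← interior_eq_empty_iff_dense_compl]
  exact interior_setOf_smul_apply_eq_eq_empty _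

/-- **… hence are DENSE in `ℍ × ℍ`** (Baire). [cite: ElkiesKumar2014HilbertModularSurfaces, §3 ("generically `2` to `1`")] -/
theorem dense_setOf_swap_mk_ne_mk (hΔ : 0 < quadDisc k l) :
    Dense {τ : Fin 2 → ℍ | hilbertModularSurface.swap hΔ (hilbertModularSurface.mk k l hΔ τ) ≠
      hilbertModularSurface.mk k l hΔ τ} :=
  dense_of_mem_residual (setOf_swap_mk_ne_mk_mem_residual hΔ)

/-- **The general `τ` in the strong sense — relation lattice `ℤ · (k, l, −1, 0, 0)` AND `σ[τ] ≠ [τ]` — form a residual,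
hence dense, subset of `ℍ × ℍ`.** [cite: ElkiesKumar2014HilbertModularSurfaces, §3 ("a very general point on the Humbert surface")] [cite: BirkenhakeWilhelm2003, §4 Prop. 4.9 (p. 1831)] -/
theorem setOf_forall_and_swap_mk_ne_mk_mem_residual (hΔ : 0 < quadDisc k l) :
    {τ : Fin 2 → ℍ | (∀ q' : Fin 5 → ℤ, singularRelation (fun i ↦ (q' i : ℂ))
        (modularEmbedding k l hΔ τ : Matrix (Fin 2) (Fin 2) ℂ) = 0 → ∃ m : ℤ, q' = m • humbertNormalForm k l) ∧
      hilbertModularSurface.swap hΔ (hilbertModularSurface.mk k l hΔ τ) ≠ hilbertModularSurface.mk k l hΔ τ} ∈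
      residual (Fin 2 → ℍ) :=
  Filter.inter_mem (setOf_forall_singularRelation_modularEmbedding_mem_residual k l hΔ)
    (setOf_swap_mk_ne_mk_mem_residual hΔ)

/-- … and are dense in `ℍ × ℍ`. [cite: ElkiesKumar2014HilbertModularSurfaces, §3] [cite: BirkenhakeWilhelm2003, §4 Prop. 4.9 (p. 1831)] -/
theorem dense_setOf_forall_and_swap_mk_ne_mk (hΔ : 0 < quadDisc k l) :
    Dense {τ : Fin 2 → ℍ | (∀ q' : Fin 5 → ℤ, singularRelation (fun i ↦ (q' i : ℂ))
        (modularEmbedding k l hΔ τ : Matrix (Fin 2) (Fin 2) ℂ) = 0 → ∃ m : ℤ, q' = m • humbertNormalForm k l) ∧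
      hilbertModularSurface.swap hΔ (hilbertModularSurface.mk k l hΔ τ) ≠ hilbertModularSurface.mk k l hΔ τ} :=
  dense_of_mem_residual (setOf_forall_and_swap_mk_ne_mk_mem_residual hΔ)

/-- **THE FIBRE OF `X → 𝒜₂` OVER THE IMAGE OF A GENERAL `[τ]` IS THE PAIR `{[τ], σ[τ]}`.**
[cite: ElkiesKumar2014HilbertModularSurfaces, §3 ("generically `2` to `1`") and §4] [cite: Runge1999EndomorphismRingsAbelianSurfaces, §4 p. 291 (Lemma 4)] -/
theorem preimage_hilbertToSiegel_singleton_eq_of_forall (hΔ : 0 < quadDisc k l) {τ : Fin 2 → ℍ}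
    (hgen : ∀ q' : Fin 5 → ℤ, singularRelation (fun i ↦ (q' i : ℂ))
      (modularEmbedding k l hΔ τ : Matrix (Fin 2) (Fin 2) ℂ) = 0 → ∃ m : ℤ, q' = m • humbertNormalForm k l) :
    hilbertToSiegel k l hΔ ⁻¹' {hilbertToSiegel k l hΔ (hilbertModularSurface.mk k l hΔ τ)} =
      {hilbertModularSurface.mk k l hΔ τ, hilbertModularSurface.swap hΔ (hilbertModularSurface.mk k l hΔ τ)} := by
  ext y
  simp only [Set.mem_preimage, Set.mem_singleton_iff, Set.mem_insert_iff]
  exact hilbertToSiegel_eq_iff_of_forall hΔ hgen y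

/-- **ELKIES–KUMAR: "THE MAP FROM THE HILBERT MODULAR SURFACE … TO THE HUMBERT SURFACE IS GENERICALLY `2` TO `1`"** —
at a general `τ` with `σ[τ] ≠ [τ]` the fibre of `X → 𝒜₂` through `[τ]` has exactly two points.
[cite: ElkiesKumar2014HilbertModularSurfaces, §3 (p. 9, "generically `2` to `1`")] -/
theorem ncard_preimage_hilbertToSiegel_singleton_eq_two (hΔ : 0 < quadDisc k l) {τ : Fin 2 → ℍ}
    (hgen : ∀ q' : Fin 5 → ℤ, singularRelation (fun i ↦ (q' i : ℂ))
      (modularEmbedding k l hΔ τ : Matrix (Fin 2) (Fin 2) ℂ) = 0 → ∃ m : ℤ, q' = m • humbertNormalForm k l)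
    (hne : hilbertModularSurface.swap hΔ (hilbertModularSurface.mk k l hΔ τ) ≠ hilbertModularSurface.mk k l hΔ τ) :
    (hilbertToSiegel k l hΔ ⁻¹' {hilbertToSiegel k l hΔ (hilbertModularSurface.mk k l hΔ τ)}).ncard = 2 := by
  rw [preimage_hilbertToSiegel_singleton_eq_of_forall hΔ hgen]
  exact Set.ncard_pair hne.symm

/-- **The two-to-one locus is dense in `X`: there is a dense set of points `y ∈ X = SL(O ⊕ O^∨)\ℍ²` over whose images
the fibre of `X → 𝒜₂` (onto the Humbert surface `H_Δ`) consists of exactly two points.** [cite: ElkiesKumar2014HilbertModularSurfaces, §3 (p. 9, "generically `2` to `1`")] -/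
theorem exists_dense_forall_ncard_preimage_hilbertToSiegel_eq_two (hΔ : 0 < quadDisc k l) :
    ∃ S : Set (hilbertModularSurface k l hΔ), Dense S ∧
      ∀ y ∈ S, (hilbertToSiegel k l hΔ ⁻¹' {hilbertToSiegel k l hΔ y}).ncard = 2 := by
  refine ⟨hilbertModularSurface.mk k l hΔ '' {τ : Fin 2 → ℍ | (∀ q' : Fin 5 → ℤ,
      singularRelation (fun i ↦ (q' i : ℂ)) (modularEmbedding k l hΔ τ : Matrix (Fin 2) (Fin 2) ℂ) = 0 →
        ∃ m : ℤ, q' = m • humbertNormalForm k l) ∧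
      hilbertModularSurface.swap hΔ (hilbertModularSurface.mk k l hΔ τ) ≠ hilbertModularSurface.mk k l hΔ τ},
    (hilbertModularSurface.mk_surjective hΔ).denseRange.dense_image (hilbertModularSurface.continuous_mk hΔ)
      (dense_setOf_forall_and_swap_mk_ne_mk hΔ), ?_⟩
  rintro _ ⟨τ, ⟨hgen, hne⟩, rfl⟩
  exact ncard_preimage_hilbertToSiegel_singleton_eq_two hΔ hgen hne

/-- On the symmetric side the same points are separated: for a general `τ` with `σ[τ] ≠ [τ]`, the fibre of the
quotient map `X → X/σ = (Γ ∪ Γσ)\ℍ²` through `[τ]` is the two-element set `{[τ], σ[τ]}` while `(Γ ∪ Γσ)\ℍ² → 𝒜₂` is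
injective there (`symmHilbertToSiegel_eq_iff_of_forall`). [cite: ElkiesKumar2014HilbertModularSurfaces, §4] -/
theorem preimage_symmHilbertModularSurface_mk_singleton_eq (hΔ : 0 < quadDisc k l) (x : hilbertModularSurface k l hΔ) :
    Quotient.mk (symmHilbertModularSurface.setoid k l hΔ) ⁻¹'
        {Quotient.mk (symmHilbertModularSurface.setoid k l hΔ) x} =
      {x, hilbertModularSurface.swap hΔ x} := by
  ext y
  simp only [Set.mem_preimage, Set.mem_singleton_iff, Set.mem_insert_iff, Quotient.eq]
  show (x = y ∨ x = hilbertModularSurface.swap hΔ y) ↔ _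
  constructor
  · rintro (rfl | rfl)
    · exact Or.inl rfl
    · exact Or.inr (hilbertModularSurface.swap_swap hΔ y).symm
  · rintro (rfl | rfl)
    · exact Or.inl rfl
    · exact Or.inr (hilbertModularSurface.swap_swap hΔ x).symm

end TwoToOne

end SiegelModuli

end Literature.AlgebraicGeometry.ModuliOfAbelianVarieties
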